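import Mathlib
import HarnessLib
import Summits.ValiantsHypothesis.ValiantsHypothesis.Theorems.KPlusLogSqLawWeakLiftingTowerGraftWronskianKFourQuotients

/-!
# Tower graft line — CONJECTURE W AT `K = 4`: DESCARTES LEVEL TABLES OF THE THREE QUOTIENTS (the `V = 2` bands)

Helper file for LINE (B) `Cruxes/WeakLifting/Lines/tower_graft.lean` (crux `WeakLifting` = stmt-ValiantsHypothesis-19561), completing the
kernel side of the level tables used by the lap-counting calculus of hand g11's memo (`evidence-g11-conjectureW-K4-levels.md` on the
item) after `…WronskianKFourLevels` / `…KFourFifthZero` / `…KFourQuotients`.  NO stub is claimed.  On the fully alternating Plücker cell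
(`p₀₁p₀₂, p₀₂p₀₃, p₀₃p₁₂, p₁₂p₁₃, p₁₃p₂₃ < 0`), with `U_k = v_k·u − u_k·v`:

* `countP_posRoots_fewnomial_four_le_pattern[_of_scale]` — generic Descartes-with-multiplicity for a `4`-nomial against ANY weak sign
  pattern `σ` (bound = number of changes of `σ`; the tree's `Census.signVariations_rsum_le_changes` + Mathlib);
* `countP_posRoots_level12_le_two` — `U₂ − c·U₁`, `c ≤ 0`: if the constant coefficient has the sign of `p₁₂·(+)` OR the top
  coefficient the sign of `p₁₂·(−)` (i.e. the level is not below BOTH thresholds `−|p₀₂|/p₀₁`, `−|p₂₃|/p₁₃`), at most TWO positive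
  roots with multiplicity; `countP_posRoots_level12_le_one_of_band` — both conditions ⇒ at most ONE (the band `[b, 0]`);
* `countP_posRoots_level31_le_two` — `U₃ − c·U₁`, `c ≥ 0` with constant coefficient of the sign of `p₀₃` (`c ≤ p₀₃/p₀₁`): `≤ 2`;
* `countP_posRoots_level23_le_two` / `…_le_one_of_band` — `U₃ − c·U₂`, `c ≤ 0`: constant coefficient of the sign of `p₀₃` ⇒ `≤ 2`;
  constant AND `X^{d₁}` coefficients of the sign of `−p₀₃` ⇒ `≤ 1`.

(The complementary rows `≤ 1` for `c ≥ 0` / `c ≤ 0` are in the two previous files; `≤ 3` always is Descartes.)  HONEST FRAMING: tables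
only; Conjecture W at `K = 4` remains OPEN; nothing on S4/S4f/S5/S5ᴸ, TowerB, `WeakLifting`, Conjecture B, `MatrixDescartes` (18050),
`VP ≠ VNP`.  Def-free.  Seat: prover leafhand-val-kpluslogsqlaw-1 g11, `--supports stmt-ValiantsHypothesis-19561 --as helper`.
[folklore: Descartes' rule of signs with multiplicity (Mathlib `roots_countP_pos_le_signVariations`)]
-/

-- `Summit.ValiantsHypothesis.ValiantsHypothesis.…` repeats a component by the D-0017 layout
-- (single-conjunct summit), which the `dupNamespace` linter flags; the name is mandated.
set_option linter.dupNamespace false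
set_option autoImplicit false

namespace Summit.ValiantsHypothesis.ValiantsHypothesis.Theorems.KPlusLogSqLaw.TowerGraft

open Polynomial Finset
open scoped BigOperators Polynomial
open Summit.ValiantsHypothesis.ValiantsHypothesis.Theorems.LacunarySymmetroidMatrixDescartes.Census
  (signVariations_rsum_le_changes mul_pos_of_mul_neg_of_mul_neg mul_neg_of_mul_pos_of_mul_neg)

namespace WronskianDevelopable

/-! ## §1 Generic weak-pattern Descartes for `4`-nomials -/

/-- **Descartes with multiplicity against an arbitrary weak sign pattern `σ`** for a `4`-nomial on a strictly increasing support: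
the positive roots counted with multiplicity are at most the number of changes of `σ`. [folklore] -/
theorem countP_posRoots_fewnomial_four_le_pattern (w : Fin 4 → ℝ) (d : Fin 4 → ℕ) (hd : StrictMono d) (σ : ℕ → Bool)
    (h0 : (σ 0 = true → 0 ≤ w 0) ∧ (σ 0 = false → w 0 ≤ 0)) (h1 : (σ 1 = true → 0 ≤ w 1) ∧ (σ 1 = false → w 1 ≤ 0))
    (h2 : (σ 2 = true → 0 ≤ w 2) ∧ (σ 2 = false → w 2 ≤ 0)) (h3 : (σ 3 = true → 0 ≤ w 3) ∧ (σ 3 = false → w 3 ≤ 0)) :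
    (∑ l, C (w l) * (X : ℝ[X]) ^ d l).roots.countP (fun x => 0 < x) ≤
      ∑ t ∈ Finset.range 3, (if σ t = σ (t + 1) then 0 else 1) := by
  obtain ⟨e, he, he0, he1, he2, he3⟩ := exists_strictMono_ext_four d hd
  rw [fewnomial_four_eq_rsum w d e he0 he1 he2 he3]
  set c : ℕ → ℝ := fun t : ℕ => if t = 0 then w 0 else if t = 1 then w 1 else if t = 2 then w 2
    else if t = 3 then w 3 else 0 with hc
  refine (Polynomial.roots_countP_pos_le_signVariations _).trans ?_
  have h := signVariations_rsum_le_changes 4 e he c σ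
    (fun t ht htt => by
      interval_cases t
      · simpa [hc] using h0.1 htt
      · simpa [hc] using h1.1 htt
      · simpa [hc] using h2.1 htt
      · simpa [hc] using h3.1 htt)
    (fun t ht htt => by
      interval_cases t
      · simpa [hc] using h0.2 htt
      · simpa [hc] using h1.2 htt
      · simpa [hc] using h2.2 htt
      · simpa [hc] using h3.2 htt)
  simpa using h

/-- the same after scaling by a nonzero constant `s` (hypotheses on `s·wₗ`). [folklore] -/
theorem countP_posRoots_fewnomial_four_le_pattern_of_scale (s : ℝ) (hs : s ≠ 0) (w : Fin 4 → ℝ) (d : Fin 4 → ℕ)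
    (hd : StrictMono d) (σ : ℕ → Bool)
    (h0 : (σ 0 = true → 0 ≤ s * w 0) ∧ (σ 0 = false → s * w 0 ≤ 0))
    (h1 : (σ 1 = true → 0 ≤ s * w 1) ∧ (σ 1 = false → s * w 1 ≤ 0))
    (h2 : (σ 2 = true → 0 ≤ s * w 2) ∧ (σ 2 = false → s * w 2 ≤ 0))
    (h3 : (σ 3 = true → 0 ≤ s * w 3) ∧ (σ 3 = false → s * w 3 ≤ 0)) :
    (∑ l, C (w l) * (X : ℝ[X]) ^ d l).roots.countP (fun x => 0 < x) ≤
      ∑ t ∈ Finset.range 3, (if σ t = σ (t + 1) then 0 else 1) := by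
  have hsc : (∑ l, C (s * w l) * (X : ℝ[X]) ^ d l).roots = (∑ l, C (w l) * (X : ℝ[X]) ^ d l).roots := by
    rw [← C_mul_fewnomial_four, roots_C_mul _ hs]
  rw [← hsc]
  exact countP_posRoots_fewnomial_four_le_pattern (fun l => s * w l) d hd σ h0 h1 h2 h3

/-! ## §2 The `V = 2` bands -/

section Cell

variable (u v : Fin 4 → ℝ) (d : Fin 4 → ℕ)

/-- **`U₂ − c·U₁`, `c ≤ 0`: at most two positive roots with multiplicity unless the level is below both thresholds.**  Scaled by
`p₁₂` the coefficients are `(p₀₂p₁₂ − c·p₀₁p₁₂, p₁₂², c·p₁₂², −p₁₂p₂₃ + c·p₁₂p₁₃)` with signs `(?, +, −, ?)`; if the first is `≥ 0`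
or the last is `≤ 0` the weak pattern has at most two changes. [this work] -/
theorem countP_posRoots_level12_le_two (hd : StrictMono d)
    (h4 : (u 1 * v 2 - u 2 * v 1) * (u 1 * v 3 - u 3 * v 1) < 0) {c : ℝ} (hc : c ≤ 0)
    (hband : 0 ≤ (u 1 * v 2 - u 2 * v 1) * ((u 0 * v 2 - u 2 * v 0) - c * (u 0 * v 1 - u 1 * v 0)) ∨
      (u 1 * v 2 - u 2 * v 1) * ((u 3 * v 2 - u 2 * v 3) - c * (u 3 * v 1 - u 1 * v 3)) ≤ 0) :
    (∑ l, C ((u l * v 2 - u 2 * v l) - c * (u l * v 1 - u 1 * v l)) * (X : ℝ[X]) ^ d l).roots.countP (fun x => 0 < x) ≤ 2 := by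
  have hne : (u 1 * v 2 - u 2 * v 1) ≠ 0 := by
    intro h; rw [h, zero_mul] at h4; exact lt_irrefl 0 h4
  set s := (u 1 * v 2 - u 2 * v 1) with hs
  have g1 : 0 ≤ s * ((u 1 * v 2 - u 2 * v 1) - c * (u 1 * v 1 - u 1 * v 1)) := by
    have e : s * ((u 1 * v 2 - u 2 * v 1) - c * (u 1 * v 1 - u 1 * v 1)) = s * s := by rw [hs]; ring
    rw [e]; exact mul_self_nonneg _
  have g2 : s * ((u 2 * v 2 - u 2 * v 2) - c * (u 2 * v 1 - u 1 * v 2)) ≤ 0 := by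
    have e : s * ((u 2 * v 2 - u 2 * v 2) - c * (u 2 * v 1 - u 1 * v 2)) = c * (s * s) := by rw [hs]; ring
    rw [e]; exact mul_nonpos_of_nonpos_of_nonneg hc (mul_self_nonneg _)
  set q0 := s * ((u 0 * v 2 - u 2 * v 0) - c * (u 0 * v 1 - u 1 * v 0)) with hq0
  set q3 := s * ((u 3 * v 2 - u 2 * v 3) - c * (u 3 * v 1 - u 1 * v 3)) with hq3
  rcases le_or_gt 0 q0 with hq0nn | hq0neg <;> rcases le_or_gt q3 0 with hq3np | hq3pos
  · -- `(+,+,−,−)`: one change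
    refine (countP_posRoots_fewnomial_four_le_pattern_of_scale s hne _ d hd (fun t => decide (t < 2))
      ⟨fun _ => hq0nn, fun h => by simp at h⟩ ⟨fun _ => g1, fun h => by simp at h⟩
      ⟨fun h => by simp at h, fun _ => g2⟩ ⟨fun h => by simp at h, fun _ => hq3np⟩).trans ?_
    simp [Finset.sum_range_succ]
  · -- `(+,+,−,+)`: two changes
    refine (countP_posRoots_fewnomial_four_le_pattern_of_scale s hne _ d hd (fun t => decide (t ≠ 2))
      ⟨fun _ => hq0nn, fun h => by simp at h⟩ ⟨fun _ => g1, fun h => by simp at h⟩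
      ⟨fun h => by simp at h, fun _ => g2⟩ ⟨fun _ => hq3pos.le, fun h => by simp at h⟩).trans ?_
    simp [Finset.sum_range_succ]
  · -- `(−,+,−,−)`: two changes
    refine (countP_posRoots_fewnomial_four_le_pattern_of_scale s hne _ d hd (fun t => decide (t = 1))
      ⟨fun h => by simp at h, fun _ => hq0neg.le⟩ ⟨fun _ => g1, fun h => by simp at h⟩
      ⟨fun h => by simp at h, fun _ => g2⟩ ⟨fun h => by simp at h, fun _ => hq3np⟩).trans ?_
    simp [Finset.sum_range_succ]
  · -- both thresholds passed: excluded by `hband`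
    exfalso
    rcases hband with h | h
    · exact absurd h (not_le.mpr hq0neg)
    · exact absurd h (not_le.mpr hq3pos)

/-- **`U₂ − c·U₁` on the band `[−min(|p₀₂|/p₀₁, |p₂₃|/p₁₃), 0]`: at most one positive root with multiplicity** (pattern
`(+,+,−,−)`). [this work] -/
theorem countP_posRoots_level12_le_one_of_band (hd : StrictMono d)
    (h4 : (u 1 * v 2 - u 2 * v 1) * (u 1 * v 3 - u 3 * v 1) < 0) {c : ℝ} (hc : c ≤ 0)
    (hlow : 0 ≤ (u 1 * v 2 - u 2 * v 1) * ((u 0 * v 2 - u 2 * v 0) - c * (u 0 * v 1 - u 1 * v 0)))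
    (htop : (u 1 * v 2 - u 2 * v 1) * ((u 3 * v 2 - u 2 * v 3) - c * (u 3 * v 1 - u 1 * v 3)) ≤ 0) :
    (∑ l, C ((u l * v 2 - u 2 * v l) - c * (u l * v 1 - u 1 * v l)) * (X : ℝ[X]) ^ d l).roots.countP (fun x => 0 < x) ≤ 1 := by
  have hne : (u 1 * v 2 - u 2 * v 1) ≠ 0 := by
    intro h; rw [h, zero_mul] at h4; exact lt_irrefl 0 h4
  refine countP_posRoots_fewnomial_four_le_one_ttff_of_scale d (u 1 * v 2 - u 2 * v 1) hne _ hd hlow ?_ ?_ htop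
  · have e : (u 1 * v 2 - u 2 * v 1) * ((u 1 * v 2 - u 2 * v 1) - c * (u 1 * v 1 - u 1 * v 1)) =
        (u 1 * v 2 - u 2 * v 1) * (u 1 * v 2 - u 2 * v 1) := by ring
    rw [e]; exact mul_self_nonneg _
  · have e : (u 1 * v 2 - u 2 * v 1) * ((u 2 * v 2 - u 2 * v 2) - c * (u 2 * v 1 - u 1 * v 2)) =
        c * ((u 1 * v 2 - u 2 * v 1) * (u 1 * v 2 - u 2 * v 1)) := by ring
    rw [e]; exact mul_nonpos_of_nonpos_of_nonneg hc (mul_self_nonneg _)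

/-- **`U₃ − c·U₁`, `c ≥ 0`, level at most `p₀₃/p₀₁` (constant coefficient of the sign of `p₀₃`): at most two positive roots with
multiplicity** (pattern `sgn p₀₃·(+,+,−,+)`). [this work] -/
theorem countP_posRoots_level31_le_two (hd : StrictMono d)
    (h1 : (u 0 * v 1 - u 1 * v 0) * (u 0 * v 2 - u 2 * v 0) < 0) (h2 : (u 0 * v 2 - u 2 * v 0) * (u 0 * v 3 - u 3 * v 0) < 0)
    (h3 : (u 0 * v 3 - u 3 * v 0) * (u 1 * v 2 - u 2 * v 1) < 0) (h4 : (u 1 * v 2 - u 2 * v 1) * (u 1 * v 3 - u 3 * v 1) < 0)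
    (h5 : (u 1 * v 3 - u 3 * v 1) * (u 2 * v 3 - u 3 * v 2) < 0) {c : ℝ} (hc : 0 ≤ c)
    (hlow : 0 ≤ (u 0 * v 3 - u 3 * v 0) * ((u 0 * v 3 - u 3 * v 0) - c * (u 0 * v 1 - u 1 * v 0))) :
    (∑ l, C ((u l * v 3 - u 3 * v l) - c * (u l * v 1 - u 1 * v l)) * (X : ℝ[X]) ^ d l).roots.countP (fun x => 0 < x) ≤ 2 := by
  obtain ⟨h03_13, h03_23, h02_23, h12_23, h02_12, hne23, hne13⟩ := cell_signs' u v h1 h2 h3 h4 h5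
  have hne03 : (u 0 * v 3 - u 3 * v 0) ≠ 0 := by
    intro h; rw [h, zero_mul] at h03_13; exact lt_irrefl 0 h03_13
  have g1 : 0 ≤ (u 0 * v 3 - u 3 * v 0) * ((u 1 * v 3 - u 3 * v 1) - c * (u 1 * v 1 - u 1 * v 1)) := by
    have e : (u 0 * v 3 - u 3 * v 0) * ((u 1 * v 3 - u 3 * v 1) - c * (u 1 * v 1 - u 1 * v 1)) =
        (u 0 * v 3 - u 3 * v 0) * (u 1 * v 3 - u 3 * v 1) := by ring
    rw [e]; exact h03_13.le
  have g2 : (u 0 * v 3 - u 3 * v 0) * ((u 2 * v 3 - u 3 * v 2) - c * (u 2 * v 1 - u 1 * v 2)) ≤ 0 := by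
    have e : (u 0 * v 3 - u 3 * v 0) * ((u 2 * v 3 - u 3 * v 2) - c * (u 2 * v 1 - u 1 * v 2)) =
        (u 0 * v 3 - u 3 * v 0) * (u 2 * v 3 - u 3 * v 2) + c * ((u 0 * v 3 - u 3 * v 0) * (u 1 * v 2 - u 2 * v 1)) := by ring
    rw [e]; nlinarith [mul_nonpos_of_nonneg_of_nonpos hc h3.le]
  have g3 : 0 ≤ (u 0 * v 3 - u 3 * v 0) * ((u 3 * v 3 - u 3 * v 3) - c * (u 3 * v 1 - u 1 * v 3)) := by
    have e : (u 0 * v 3 - u 3 * v 0) * ((u 3 * v 3 - u 3 * v 3) - c * (u 3 * v 1 - u 1 * v 3)) =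
        c * ((u 0 * v 3 - u 3 * v 0) * (u 1 * v 3 - u 3 * v 1)) := by ring
    rw [e]; exact mul_nonneg hc h03_13.le
  refine (countP_posRoots_fewnomial_four_le_pattern_of_scale (u 0 * v 3 - u 3 * v 0) hne03 _ d hd (fun t => decide (t ≠ 2))
    ⟨fun _ => hlow, fun h => by simp at h⟩ ⟨fun _ => g1, fun h => by simp at h⟩
    ⟨fun h => by simp at h, fun _ => g2⟩ ⟨fun _ => g3, fun h => by simp at h⟩).trans ?_
  simp [Finset.sum_range_succ]

/-- **`U₃ − c·U₂`, `c ≤ 0`, constant coefficient of the sign of `p₀₃` (level at least `−p₀₃/|p₀₂|`): at most two positive roots with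
multiplicity** (patterns `sgn p₀₃·(+,±,−,+)`). [this work] -/
theorem countP_posRoots_level23_le_two (hd : StrictMono d)
    (h1 : (u 0 * v 1 - u 1 * v 0) * (u 0 * v 2 - u 2 * v 0) < 0) (h2 : (u 0 * v 2 - u 2 * v 0) * (u 0 * v 3 - u 3 * v 0) < 0)
    (h3 : (u 0 * v 3 - u 3 * v 0) * (u 1 * v 2 - u 2 * v 1) < 0) (h4 : (u 1 * v 2 - u 2 * v 1) * (u 1 * v 3 - u 3 * v 1) < 0)
    (h5 : (u 1 * v 3 - u 3 * v 1) * (u 2 * v 3 - u 3 * v 2) < 0) {c : ℝ} (hc : c ≤ 0)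
    (hlow : 0 ≤ (u 0 * v 3 - u 3 * v 0) * ((u 0 * v 3 - u 3 * v 0) - c * (u 0 * v 2 - u 2 * v 0))) :
    (∑ l, C ((u l * v 3 - u 3 * v l) - c * (u l * v 2 - u 2 * v l)) * (X : ℝ[X]) ^ d l).roots.countP (fun x => 0 < x) ≤ 2 := by
  obtain ⟨h03_13, h03_23, h02_23, h12_23, h02_12, hne23, hne13⟩ := cell_signs' u v h1 h2 h3 h4 h5
  have hne03 : (u 0 * v 3 - u 3 * v 0) ≠ 0 := by
    intro h; rw [h, zero_mul] at h03_13; exact lt_irrefl 0 h03_13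
  have g2 : (u 0 * v 3 - u 3 * v 0) * ((u 2 * v 3 - u 3 * v 2) - c * (u 2 * v 2 - u 2 * v 2)) ≤ 0 := by
    have e : (u 0 * v 3 - u 3 * v 0) * ((u 2 * v 3 - u 3 * v 2) - c * (u 2 * v 2 - u 2 * v 2)) =
        (u 0 * v 3 - u 3 * v 0) * (u 2 * v 3 - u 3 * v 2) := by ring
    rw [e]; exact h03_23.le
  have g3 : 0 ≤ (u 0 * v 3 - u 3 * v 0) * ((u 3 * v 3 - u 3 * v 3) - c * (u 3 * v 2 - u 2 * v 3)) := by
    have e : (u 0 * v 3 - u 3 * v 0) * ((u 3 * v 3 - u 3 * v 3) - c * (u 3 * v 2 - u 2 * v 3)) =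
        c * ((u 0 * v 3 - u 3 * v 0) * (u 2 * v 3 - u 3 * v 2)) := by ring
    rw [e]; exact mul_nonneg_of_nonpos_of_nonpos hc h03_23.le
  set q1 := (u 0 * v 3 - u 3 * v 0) * ((u 1 * v 3 - u 3 * v 1) - c * (u 1 * v 2 - u 2 * v 1)) with hq1
  rcases le_or_gt 0 q1 with hq1nn | hq1neg
  · -- `(+,+,−,+)`
    refine (countP_posRoots_fewnomial_four_le_pattern_of_scale (u 0 * v 3 - u 3 * v 0) hne03 _ d hd (fun t => decide (t ≠ 2))
      ⟨fun _ => hlow, fun h => by simp at h⟩ ⟨fun _ => hq1nn, fun h => by simp at h⟩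
      ⟨fun h => by simp at h, fun _ => g2⟩ ⟨fun _ => g3, fun h => by simp at h⟩).trans ?_
    simp [Finset.sum_range_succ]
  · -- `(+,−,−,+)`
    refine (countP_posRoots_fewnomial_four_le_pattern_of_scale (u 0 * v 3 - u 3 * v 0) hne03 _ d hd
      (fun t => decide (t = 0 ∨ t = 3))
      ⟨fun _ => hlow, fun h => by simp at h⟩ ⟨fun h => by simp at h, fun _ => hq1neg.le⟩
      ⟨fun h => by simp at h, fun _ => g2⟩ ⟨fun _ => g3, fun h => by simp at h⟩).trans ?_
    simp [Finset.sum_range_succ]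

/-- **`U₃ − c·U₂`, `c ≤ 0`, below BOTH thresholds (constant and `X^{d₁}` coefficients of the sign of `−p₀₃`): at most ONE positive
root with multiplicity** (pattern `sgn p₀₃·(−,−,−,+)`). [this work] -/
theorem countP_posRoots_level23_le_one_of_band (hd : StrictMono d)
    (h1 : (u 0 * v 1 - u 1 * v 0) * (u 0 * v 2 - u 2 * v 0) < 0) (h2 : (u 0 * v 2 - u 2 * v 0) * (u 0 * v 3 - u 3 * v 0) < 0)
    (h3 : (u 0 * v 3 - u 3 * v 0) * (u 1 * v 2 - u 2 * v 1) < 0) (h4 : (u 1 * v 2 - u 2 * v 1) * (u 1 * v 3 - u 3 * v 1) < 0)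
    (h5 : (u 1 * v 3 - u 3 * v 1) * (u 2 * v 3 - u 3 * v 2) < 0) {c : ℝ} (hc : c ≤ 0)
    (hlow : (u 0 * v 3 - u 3 * v 0) * ((u 0 * v 3 - u 3 * v 0) - c * (u 0 * v 2 - u 2 * v 0)) ≤ 0)
    (hone : (u 0 * v 3 - u 3 * v 0) * ((u 1 * v 3 - u 3 * v 1) - c * (u 1 * v 2 - u 2 * v 1)) ≤ 0) :
    (∑ l, C ((u l * v 3 - u 3 * v l) - c * (u l * v 2 - u 2 * v l)) * (X : ℝ[X]) ^ d l).roots.countP (fun x => 0 < x) ≤ 1 := by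
  obtain ⟨h03_13, h03_23, h02_23, h12_23, h02_12, hne23, hne13⟩ := cell_signs' u v h1 h2 h3 h4 h5
  have hne03 : (u 0 * v 3 - u 3 * v 0) ≠ 0 := by
    intro h; rw [h, zero_mul] at h03_13; exact lt_irrefl 0 h03_13
  have g2 : (u 0 * v 3 - u 3 * v 0) * ((u 2 * v 3 - u 3 * v 2) - c * (u 2 * v 2 - u 2 * v 2)) ≤ 0 := by
    have e : (u 0 * v 3 - u 3 * v 0) * ((u 2 * v 3 - u 3 * v 2) - c * (u 2 * v 2 - u 2 * v 2)) =
        (u 0 * v 3 - u 3 * v 0) * (u 2 * v 3 - u 3 * v 2) := by ring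
    rw [e]; exact h03_23.le
  have g3 : 0 ≤ (u 0 * v 3 - u 3 * v 0) * ((u 3 * v 3 - u 3 * v 3) - c * (u 3 * v 2 - u 2 * v 3)) := by
    have e : (u 0 * v 3 - u 3 * v 0) * ((u 3 * v 3 - u 3 * v 3) - c * (u 3 * v 2 - u 2 * v 3)) =
        c * ((u 0 * v 3 - u 3 * v 0) * (u 2 * v 3 - u 3 * v 2)) := by ring
    rw [e]; exact mul_nonneg_of_nonpos_of_nonpos hc h03_23.le
  refine (countP_posRoots_fewnomial_four_le_pattern_of_scale (u 0 * v 3 - u 3 * v 0) hne03 _ d hd (fun t => decide (t = 3))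
    ⟨fun h => by simp at h, fun _ => hlow⟩ ⟨fun h => by simp at h, fun _ => hone⟩
    ⟨fun h => by simp at h, fun _ => g2⟩ ⟨fun _ => g3, fun h => by simp at h⟩).trans ?_
  simp [Finset.sum_range_succ]

end Cell

end WronskianDevelopable

end Summit.ValiantsHypothesis.ValiantsHypothesis.Theorems.KPlusLogSqLaw.TowerGraft
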